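import Mathlib
import Literature.MathematicalPhysics.StatisticalMechanics.Crystallization
import Literature.MathematicalPhysics.StatisticalMechanics.LennardJonesClusters

/-!
# Crux `ExactCertificate` (stmt-AtomisticToContinuum-11959), line `closure-makes-nogap-exact`,
# Transfer skeleton II `Crystallization1D` — stub `stub_lineMinGap`: uniform minimal gap `3/4`

Support file (`--supports stmt-AtomisticToContinuum-11959`); nothing here closes the 3-D crux.

Transfer skeleton II (`…Cruxes.ExactCertificate.Transfer1D.Crystallization1D`, crystallization of the
Lennard-Jones CHAIN, `d = 1`) needs the MINIMALITY BOX `3/4 ≤ y (i+1) − y i ≤ 1` for the sorted positions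
`y` of a Lennard-Jones ground state of `N` particles on a line.  This file proves the lower half
(`stub_lineMinGap`): if `y` is strictly increasing on `range N` and minimises the line energy
`∑_{i<j<N} V(|y j − y i|)`, `V = lennardJones`, among all configurations of `N` distinct reals, then every
nearest-neighbour gap is `≥ 3/4`.

Mechanism (move the left particle of a closest pair beyond the far end).  Let `δ = y (i₀+1) − y i₀` be
the smallest gap.  All gaps are `≥ δ`, so `|y k − y i₀| ≥ |k − i₀| δ`; with `V(r) ≥ −r⁻⁶/6` and the
tail bound `∑_{m ≥ 2} m⁻⁶ ≤ 1/8` (from `m⁻⁶ ≤ (1/8)(1/(m−1) − 1/m)`), the OLD site energy of particle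
`i₀` is `≥ δ⁻¹²/12 − (3/8) δ⁻⁶ = (δ⁻⁶/12)(δ⁻⁶ − 9/2)`, which is `> 0` as soon as `δ < 3/4`
(`(4/3)⁶ = 4096/729 > 9/2`).  Its NEW site energy at the position `y (N−1) + 1` is `≤ 0` (all distances
are `≥ 1`, where `V ≤ 0`).  Only pairs containing `i₀` change (`minGap_pairSum_eq`), so the move strictly
lowers the line energy, contradicting minimality.
-/

noncomputable section

namespace Summit.AtomisticToContinuum.Crystallization.Theorems.ThreeConeCertificateExactCertificate.Transfer1D

open Literature.MathematicalPhysics.StatisticalMechanics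
open scoped BigOperators

/-! ## Bookkeeping: pairs containing a given index -/

/-- Localisation of the triangular pair sum: if `H i j = 0` unless `i = i₀` or `j = i₀`, then
`∑_{i<j<N} H i j = ∑_{i₀<j<N} H i₀ j + ∑_{i<i₀} H i i₀` (`i₀ < N`). [folklore] -/
theorem minGap_pairSum_eq {N i₀ : ℕ} (hi₀ : i₀ < N) (H : ℕ → ℕ → ℝ)
    (hH : ∀ i j, i ≠ i₀ → j ≠ i₀ → H i j = 0) :
    ∑ i ∈ Finset.range N, ∑ j ∈ Finset.Ico (i + 1) N, H i j =
      ∑ j ∈ Finset.Ico (i₀ + 1) N, H i₀ j + ∑ i ∈ Finset.range i₀, H i i₀ := by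
  have key : ∀ i ∈ Finset.range N, ∑ j ∈ Finset.Ico (i + 1) N, H i j =
      ∑ j ∈ Finset.Ico (i + 1) N,
        ((if i = i₀ then H i j else 0) + (if j = i₀ then H i j else 0)) := by
    intro i _
    refine Finset.sum_congr rfl fun j hj => ?_
    rw [Finset.mem_Ico] at hj
    by_cases h1 : i = i₀
    · have h2 : j ≠ i₀ := by omega
      rw [if_pos h1, if_neg h2, add_zero]
    · by_cases h2 : j = i₀
      · rw [if_neg h1, if_pos h2, zero_add]
      · rw [if_neg h1, if_neg h2, add_zero, hH i j h1 h2]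
  rw [Finset.sum_congr rfl key]
  simp only [Finset.sum_add_distrib]
  congr 1
  · rw [Finset.sum_eq_single_of_mem i₀ (Finset.mem_range.2 hi₀)]
    · exact Finset.sum_congr rfl fun j _ => if_pos rfl
    · intro i _ hi
      exact Finset.sum_eq_zero fun j _ => if_neg hi
  · rw [Finset.sum_congr rfl fun i _ => Finset.sum_ite_eq' (Finset.Ico (i + 1) N) i₀ (H i),
      ← Finset.sum_filter]
    refine Finset.sum_congr ?_ fun _ _ => rfl
    ext i
    simp only [Finset.mem_filter, Finset.mem_range, Finset.mem_Ico]
    omega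

/-! ## Telescoping and the tail of `ζ(6)` -/

/-- If all nearest-neighbour gaps on `range N` are `≥ δ`, then `y (p + d) − y p ≥ d δ` for `p + d < N`.
[folklore] -/
theorem minGap_le_sub {N : ℕ} {y : ℕ → ℝ} {δ : ℝ}
    (hgap : ∀ k, k + 1 < N → δ ≤ y (k + 1) - y k) :
    ∀ d p : ℕ, p + d < N → (d : ℝ) * δ ≤ y (p + d) - y p := by
  intro d
  induction d with
  | zero => intro p _; simp
  | succ d ih =>
    intro p hp
    have h1 := ih p (by omega)
    have h2 := hgap (p + d) (by omega)
    rw [show p + (d + 1) = p + d + 1 by omega]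
    push_cast
    linarith

/-- Tail of `ζ(6)`: `∑_{k<n} (k+2)⁻⁶ ≤ 1/8`, from `(k+2)⁻⁶ ≤ (1/8)((k+1)⁻¹ − (k+2)⁻¹)`
(i.e. `8(k+1) ≤ (k+2)⁵`) and telescoping. [folklore] -/
theorem minGap_sum_inv_pow_six_tail (n : ℕ) :
    ∑ k ∈ Finset.range n, (((k : ℝ) + 2)⁻¹) ^ 6 ≤ 1 / 8 := by
  have hterm : ∀ k ∈ Finset.range n, (((k : ℝ) + 2)⁻¹) ^ 6 ≤
      (1 / 8) * (((k : ℝ) + 1)⁻¹ - ((k : ℝ) + 1 + 1)⁻¹) := by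
    intro k _
    have hk : (0 : ℝ) ≤ k := k.cast_nonneg
    have h1 : (0 : ℝ) < (k : ℝ) + 1 := by positivity
    have h2 : (0 : ℝ) < (k : ℝ) + 2 := by positivity
    have hpoly : 8 * ((k : ℝ) + 1) ≤ ((k : ℝ) + 2) ^ 5 := by
      nlinarith [pow_nonneg hk 2, pow_nonneg hk 3, pow_nonneg hk 4, pow_nonneg hk 5]
    rw [show (1 / 8 : ℝ) * (((k : ℝ) + 1)⁻¹ - ((k : ℝ) + 1 + 1)⁻¹) =
        (8 * ((k : ℝ) + 1) * ((k : ℝ) + 2))⁻¹ by field_simp; ring]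
    rw [inv_pow, inv_le_inv₀ (by positivity) (by positivity)]
    calc 8 * ((k : ℝ) + 1) * ((k : ℝ) + 2) ≤ ((k : ℝ) + 2) ^ 5 * ((k : ℝ) + 2) :=
          mul_le_mul_of_nonneg_right hpoly h2.le
      _ = ((k : ℝ) + 2) ^ 6 := by ring
  have htel := Finset.sum_range_sub' (fun k : ℕ => ((k : ℝ) + 1)⁻¹) n
  simp only [Nat.cast_succ, Nat.cast_zero, zero_add, inv_one] at htel
  have hn : (0 : ℝ) ≤ ((n : ℝ) + 1)⁻¹ := by positivity
  calc ∑ k ∈ Finset.range n, (((k : ℝ) + 2)⁻¹) ^ 6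
      ≤ ∑ k ∈ Finset.range n, (1 / 8) * (((k : ℝ) + 1)⁻¹ - ((k : ℝ) + 1 + 1)⁻¹) :=
        Finset.sum_le_sum hterm
    _ = (1 / 8) * (1 - ((n : ℝ) + 1)⁻¹) := by rw [← Finset.mul_sum, htel]
    _ ≤ 1 / 8 := by nlinarith

/-- Partial sums of `ζ(6)`: `∑_{k<n} (k+1)⁻⁶ ≤ 9/8`. [folklore] -/
theorem minGap_sum_inv_pow_six (n : ℕ) :
    ∑ k ∈ Finset.range n, (((k : ℝ) + 1)⁻¹) ^ 6 ≤ 9 / 8 := by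
  cases n with
  | zero => norm_num
  | succ n =>
    rw [Finset.sum_range_succ']
    have h := minGap_sum_inv_pow_six_tail n
    have e : ∀ k : ℕ, (((k + 1 : ℕ) : ℝ) + 1) = (k : ℝ) + 2 := fun k => by push_cast; ring
    simp only [e, Nat.cast_zero, zero_add, inv_one, one_pow]
    linarith

/-! ## The site energy of a crowded particle -/

/-- If the smallest nearest-neighbour gap `δ = y (i₀+1) − y i₀` of an increasing configuration on
`range N` is `< 3/4`, then the site energy of particle `i₀`, `∑_{k ≠ i₀} V(|y k − y i₀|)`, is `> 0`:
it is `≥ δ⁻¹²/12 − (3/8)δ⁻⁶` and `δ⁻⁶ > (4/3)⁶ > 9/2`. [folklore] -/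
theorem minGap_siteEnergy_pos {N i₀ : ℕ} {y : ℕ → ℝ} {δ : ℝ} (hi₀ : i₀ + 1 < N)
    (hδ : y (i₀ + 1) - y i₀ = δ) (hδpos : 0 < δ) (hδlt : δ < 3 / 4)
    (hgap : ∀ k, k + 1 < N → δ ≤ y (k + 1) - y k) :
    0 < ∑ j ∈ Finset.Ico (i₀ + 1) N, lennardJones (|y j - y i₀|) +
      ∑ p ∈ Finset.range i₀, lennardJones (|y i₀ - y p|) := by
  have htel := minGap_le_sub hgap
  -- right neighbours: the closest one exactly, the others through the attractive tail
  have hR : (1 / 12) * (δ⁻¹) ^ 12 - (1 / 6) * (δ⁻¹) ^ 6 - (1 / 6) * (δ⁻¹) ^ 6 * (1 / 8) ≤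
      ∑ j ∈ Finset.Ico (i₀ + 1) N, lennardJones (|y j - y i₀|) := by
    rw [Finset.sum_Ico_eq_sum_range]
    obtain ⟨n, hn⟩ : ∃ n, N - (i₀ + 1) = n + 1 := ⟨N - (i₀ + 1) - 1, by omega⟩
    rw [hn, Finset.sum_range_succ', add_zero, hδ, abs_of_pos hδpos]
    have h0 : lennardJones δ = (1 / 12) * (δ⁻¹) ^ 12 - (1 / 6) * (δ⁻¹) ^ 6 := rfl
    have hk : ∀ k ∈ Finset.range n, -((1 / 6) * (δ⁻¹) ^ 6 * (((k : ℝ) + 2)⁻¹) ^ 6) ≤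
        lennardJones (|y (i₀ + 1 + (k + 1)) - y i₀|) := by
      intro k hk
      rw [Finset.mem_range] at hk
      have h := htel (k + 2) i₀ (by omega)
      rw [show i₀ + 1 + (k + 1) = i₀ + (k + 2) by omega]
      push_cast at h
      have hpos : (0 : ℝ) < ((k : ℝ) + 2) * δ := by positivity
      have hb := neg_le_lennardJones_of_le hpos (h.trans (le_abs_self _))
      rw [mul_inv, mul_pow] at hb
      linarith
    have htail : -((1 / 6) * (δ⁻¹) ^ 6 * (1 / 8)) ≤
        ∑ k ∈ Finset.range n, lennardJones (|y (i₀ + 1 + (k + 1)) - y i₀|) :=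
      calc -((1 / 6) * (δ⁻¹) ^ 6 * (1 / 8))
          ≤ -((1 / 6) * (δ⁻¹) ^ 6 * ∑ k ∈ Finset.range n, (((k : ℝ) + 2)⁻¹) ^ 6) := by
            have hs := minGap_sum_inv_pow_six_tail n
            have h6 : (0 : ℝ) ≤ (1 / 6) * (δ⁻¹) ^ 6 := by positivity
            linarith [mul_le_mul_of_nonneg_left hs h6]
        _ = ∑ k ∈ Finset.range n, -((1 / 6) * (δ⁻¹) ^ 6 * (((k : ℝ) + 2)⁻¹) ^ 6) := by
            rw [Finset.mul_sum, Finset.sum_neg_distrib]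
        _ ≤ _ := Finset.sum_le_sum hk
    linarith
  -- left neighbours: all through the attractive tail
  have hL : -((1 / 6) * (δ⁻¹) ^ 6 * (9 / 8)) ≤
      ∑ p ∈ Finset.range i₀, lennardJones (|y i₀ - y p|) := by
    rw [← Finset.sum_range_reflect (fun p => lennardJones (|y i₀ - y p|)) i₀]
    have hk : ∀ k ∈ Finset.range i₀, -((1 / 6) * (δ⁻¹) ^ 6 * (((k : ℝ) + 1)⁻¹) ^ 6) ≤
        lennardJones (|y i₀ - y (i₀ - 1 - k)|) := by
      intro k hk
      rw [Finset.mem_range] at hk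
      have h := htel (k + 1) (i₀ - 1 - k) (by omega)
      rw [show i₀ - 1 - k + (k + 1) = i₀ by omega] at h
      push_cast at h
      have hpos : (0 : ℝ) < ((k : ℝ) + 1) * δ := by positivity
      have hb := neg_le_lennardJones_of_le hpos (h.trans (le_abs_self _))
      rw [mul_inv, mul_pow] at hb
      linarith
    calc -((1 / 6) * (δ⁻¹) ^ 6 * (9 / 8))
        ≤ -((1 / 6) * (δ⁻¹) ^ 6 * ∑ k ∈ Finset.range i₀, (((k : ℝ) + 1)⁻¹) ^ 6) := by
          have hs := minGap_sum_inv_pow_six i₀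
          have h6 : (0 : ℝ) ≤ (1 / 6) * (δ⁻¹) ^ 6 := by positivity
          linarith [mul_le_mul_of_nonneg_left hs h6]
      _ = ∑ k ∈ Finset.range i₀, -((1 / 6) * (δ⁻¹) ^ 6 * (((k : ℝ) + 1)⁻¹) ^ 6) := by
          rw [Finset.mul_sum, Finset.sum_neg_distrib]
      _ ≤ _ := Finset.sum_le_sum hk
  -- numerics: `u = δ⁻⁶ > (4/3)⁶ > 9/2`, total `≥ u²/12 − 3u/8 > 0`
  have hδinv : (4 : ℝ) / 3 < δ⁻¹ := by
    rw [show (4 : ℝ) / 3 = (3 / 4)⁻¹ by norm_num]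
    exact (inv_lt_inv₀ (by norm_num) hδpos).2 hδlt
  have h6 : ((4 : ℝ) / 3) ^ 6 < (δ⁻¹) ^ 6 := pow_lt_pow_left₀ hδinv (by norm_num) (by norm_num)
  have hu : (9 : ℝ) / 2 < (δ⁻¹) ^ 6 := lt_trans (by norm_num) h6
  have hu0 : (0 : ℝ) < (δ⁻¹) ^ 6 := by positivity
  have h12 : (δ⁻¹) ^ 12 = ((δ⁻¹) ^ 6) ^ 2 := by ring
  rw [h12] at hR
  nlinarith [mul_pos hu0 (sub_pos.2 hu), hR, hL]

/-! ## The stub -/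

/-- STUB (B) `stub_lineMinGap` — MINIMAL GAP `3/4`.  A strictly increasing configuration minimising the
Lennard-Jones line energy among all configurations of `N` distinct reals has all nearest-neighbour gaps
`≥ 3/4`: move the left particle `i₀` of a closest pair (gap `δ < 3/4`) to `y (N−1) + 1`; its old site
energy is `≥ δ⁻¹²/12 − (3/8)δ⁻⁶ > 0`, its new one is `≤ 0`, and no other pair changes. [folklore] -/
theorem stub_lineMinGap : ∀ (N : ℕ) (y : ℕ → ℝ),
    (∀ i j : ℕ, i < j → j < N → y i < y j) →
    (∀ y' : ℕ → ℝ, (∀ i j : ℕ, i < j → j < N → y' i ≠ y' j) →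
      ∑ i ∈ Finset.range N, ∑ j ∈ Finset.Ico (i + 1) N, lennardJones (|y j - y i|) ≤
        ∑ i ∈ Finset.range N, ∑ j ∈ Finset.Ico (i + 1) N, lennardJones (|y' j - y' i|)) →
    ∀ i : ℕ, i + 1 < N → 3 / 4 ≤ y (i + 1) - y i := by
  intro N y hmono hmin i hi
  by_contra hlt
  rw [not_le] at hlt
  -- a closest pair `(i₀, i₀ + 1)` and its gap `δ`
  obtain ⟨i₀, hi₀mem, hi₀min⟩ := Finset.exists_min_image (Finset.range (N - 1))
    (fun k => y (k + 1) - y k) ⟨i, Finset.mem_range.2 (by omega)⟩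
  rw [Finset.mem_range] at hi₀mem
  have hi₀N : i₀ + 1 < N := by omega
  obtain ⟨δ, hδ⟩ : ∃ δ : ℝ, y (i₀ + 1) - y i₀ = δ := ⟨_, rfl⟩
  have hδpos : 0 < δ := by
    rw [← hδ]
    exact sub_pos.2 (hmono i₀ (i₀ + 1) (Nat.lt_succ_self _) hi₀N)
  have hgap : ∀ k, k + 1 < N → δ ≤ y (k + 1) - y k := fun k hk => by
    rw [← hδ]
    exact hi₀min k (Finset.mem_range.2 (by omega))
  have hδlt : δ < 3 / 4 := (hgap i hi).trans_lt hlt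
  -- the competitor: particle `i₀` moved beyond the right end
  obtain ⟨y', hy'⟩ : ∃ y' : ℕ → ℝ, ∀ k, y' k = if k = i₀ then y (N - 1) + 1 else y k :=
    ⟨_, fun _ => rfl⟩
  have hy'i₀ : y' i₀ = y (N - 1) + 1 := by rw [hy', if_pos rfl]
  have hy'ne : ∀ k, k ≠ i₀ → y' k = y k := fun k hk => by rw [hy', if_neg hk]
  have hyle : ∀ k, k < N → y k ≤ y (N - 1) := fun k hk => by
    rcases Nat.lt_or_ge k (N - 1) with h | h
    · exact (hmono k (N - 1) h (by omega)).le
    · rw [show k = N - 1 by omega]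
  have hdist : ∀ p q : ℕ, p < q → q < N → y' p ≠ y' q := by
    intro p q hpq hq
    by_cases hp : p = i₀
    · rw [hp, hy'i₀, hy'ne q (by omega)]
      have := hyle q hq
      exact ne_of_gt (by linarith)
    · by_cases hq' : q = i₀
      · rw [hq', hy'i₀, hy'ne p hp]
        have := hyle p (by omega)
        exact ne_of_lt (by linarith)
      · rw [hy'ne p hp, hy'ne q hq']
        exact (hmono p q hpq hq).ne
  have hE := hmin y' hdist
  -- only pairs containing `i₀` change
  have hFG : ∀ p q : ℕ, p ≠ i₀ → q ≠ i₀ →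
      lennardJones (|y q - y p|) - lennardJones (|y' q - y' p|) = 0 := fun p q hp hq => by
    rw [hy'ne p hp, hy'ne q hq, sub_self]
  have hsplit := minGap_pairSum_eq (show i₀ < N by omega)
    (fun p q => lennardJones (|y q - y p|) - lennardJones (|y' q - y' p|)) hFG
  simp only [Finset.sum_sub_distrib] at hsplit
  -- old site energy `> 0`, new site energy `≤ 0`
  have hold := minGap_siteEnergy_pos hi₀N hδ hδpos hδlt hgap
  have hnew1 : ∑ j ∈ Finset.Ico (i₀ + 1) N, lennardJones (|y' j - y' i₀|) ≤ 0 := by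
    refine Finset.sum_nonpos fun j hj => ?_
    rw [Finset.mem_Ico] at hj
    rw [hy'ne j (by omega), hy'i₀]
    have := hyle j hj.2
    refine lennardJones_nonpos ?_
    rw [abs_sub_comm, abs_of_nonneg (by linarith)]
    linarith
  have hnew2 : ∑ p ∈ Finset.range i₀, lennardJones (|y' i₀ - y' p|) ≤ 0 := by
    refine Finset.sum_nonpos fun p hp => ?_
    rw [Finset.mem_range] at hp
    rw [hy'ne p (by omega), hy'i₀]
    have := hyle p (by omega)
    refine lennardJones_nonpos ?_
    rw [abs_of_nonneg (by linarith)]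
    linarith
  linarith

end Summit.AtomisticToContinuum.Crystallization.Theorems.ThreeConeCertificateExactCertificate.Transfer1D
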